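import Summits.RiemannHypothesis.RiemannHypothesis.Theorems.TiltedLandingLaw421R3SinkK1FarB
import Summits.RiemannHypothesis.RiemannHypothesis.Theorems.TiltedLandingLaw421R3SinkK1LidLink

/-!
# C3 (rh-idea-3 g57) — «K1Bdry»: rule-`y0 = 1` BOUNDARY DOMINATION at `R = 2` on MAIN — the conjunction of 120 · 122 · «K1LidLink»

`bdryDomForm_two_K1_main : 1/8 ≤ t → t ≤ 2/3 → 0 ≤ d → d ≤ 33/128 → d(2 − d) < t² → BdryDomForm 2 d t h 1 (cornerSigmaForm 2 d t h 1)` (110's `BdryDomForm`, #1261 :191,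
with `(2:ℝ)/2` normalised to `1`) := ⟨`RhW08.K1NearColumnLink.near_column_K1_main` (120 = #1272), `RhW08.K1FarColumn.far_column_K1_main` (122), `RhW08.K1Lid.right_lid_K1_main`,
`RhW08.K1Lid.left_lid_K1_main` («K1LidLink»)⟩; and its `KernelDomBdry` reading for the real two-point cut family via 110's `kernelDomBdry_realTwoPoint_iff`.
TWO imports («K1FarB» ⊇ 120, 121; «K1LidLink» ⊇ the three lid-certificate files).  0 `sorry`; 0 `set_option`.  Scope NOT covered (booked, not a defect): SMALL `t < R/16`,
general `R` (C1's 118 «SinkScale» `bdryDomForm_scale` moves `R = 2` to every `R > 0` once the state is rescaled), left-sided children (117 «SinkMirror»), rules `y0 = 0` / kink.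
Level: SUPPORT.  Nothing here bears on the truth of RH; RH is not proved; ⟨33346⟩/⟨33347⟩ OPEN; a certified polynomial inequality on a rectangle decides nothing about ξ.
-/

noncomputable section

namespace RhW08.K1Bdry

open RhW08.SinkTemplate RhW08.SinkBdry

/-- ★ K1 BOUNDARY DOMINATION AT `R = 2` ON MAIN (rule `y0 = 1`, right-sided strict cone child, any top height `h`): all four conjuncts of 110's `BdryDomForm`. -/
theorem bdryDomForm_two_K1_main (d t h : ℝ) (ht₁ : ((1 : ℝ) / 8) ≤ t) (ht₂ : t ≤ ((2 : ℝ) / 3)) (hd₁ : (0 : ℝ) ≤ d) (hd₂ : d ≤ ((33 : ℝ) / 128))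
    (hcone : d * (2 - d) < t ^ 2) :
    BdryDomForm 2 d t h 1 (cornerSigmaForm 2 d t h 1) := by
  unfold BdryDomForm
  rw [show ((2 : ℝ) / 2) = 1 by norm_num]
  refine ⟨fun b hb0 hb1 => ?_, fun b hb0 hb1 => ?_, fun ξ hξ => ?_, fun ξ hξ => ?_⟩
  · exact RhW08.K1NearColumnLink.near_column_K1_main d t h b ht₁ ht₂ hd₁ hd₂ hcone hb0 hb1
  · exact RhW08.K1FarColumn.far_column_K1_main d t h b ht₁ ht₂ hd₁ hd₂ hcone hb0 hb1
  · exact RhW08.K1Lid.right_lid_K1_main d t h ξ ht₁ ht₂ hd₁ hd₂ hcone hξ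
  · exact RhW08.K1Lid.left_lid_K1_main d t h ξ ht₁ ht₂ hd₁ hd₂ hcone hξ

/-- the same fact read as 102's boundary kernel domination `KernelDomBdry` for the real two-point cut family `realTwoPoint xv h 1 w` (110's dictionary
`kernelDomBdry_realTwoPoint_iff`): window half-width `R/2 = 1` around `xv`, child `w` with `t = Im w`, `d = Re w − xv`. -/
theorem kernelDomBdry_two_K1_main (xv h : ℝ) (w : ℂ) (ht₁ : ((1 : ℝ) / 8) ≤ w.im) (ht₂ : w.im ≤ ((2 : ℝ) / 3)) (hd₁ : (0 : ℝ) ≤ w.re - xv)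
    (hd₂ : w.re - xv ≤ ((33 : ℝ) / 128)) (hcone : (w.re - xv) * (2 - (w.re - xv)) < w.im ^ 2) :
    KernelDomBdry xv 2 (realTwoPoint xv h 1 w) w (cornerSigmaForm 2 (w.re - xv) w.im h 1) :=
  (kernelDomBdry_realTwoPoint_iff xv 2 h 1 (by norm_num) w _).2 (bdryDomForm_two_K1_main (w.re - xv) w.im h ht₁ ht₂ hd₁ hd₂ hcone)

end RhW08.K1Bdry

end
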